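import Literature.AnabelianGeometry.EtaleTheta.Discharge.Sec2Cor219iiiCompatibleExponents
import Literature.AnabelianGeometry.EtaleTheta.Discharge.Sec2Cor219iiiHeartAtModelChi
import Literature.AnabelianGeometry.EtaleTheta.Discharge.Sec2Cor219iiiConjRootPeriodicityAtModelChi
import Literature.AnabelianGeometry.EtaleTheta.Discharge.Sec1Thm110ModelTateNV
import Literature.AnabelianGeometry.EtaleTheta.Discharge.Sec2RigidityAtModelTate
import HarnessLib

/-!
# [EtTh] Cor. 2.19 (iii) (`ThetaEnvTower.Cor219_iii`) at the Tate model on the LEVEL-DEPENDENT route, modulo the POINT-HEARTS clause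
# (row «COR219III-M1b», FILE 3; proof-only instantiation of abc-iut-f-142's `cor219_iii_of_pointHearts_of_sq_of_origin`)

S. Mochizuki, *The Étale Theta Function and its Frobenioid-theoretic Manifestations* [EtTh], Publ. RIMS **45** (2009), §2
Cor. 2.19 (iii) p. 65 [cite: MochizukiEtTh2009, Cor 2.19 (iii) p.65].  Cell `abc-iut`, K-L6 row «COR219III-M1b» (abc-iut-L6-lead
gen 7/8), seat abc-iut-L1-t6 (gen 5), FILE 3 (division (A) of 2026-08-27T04:00Z).  PROOF-ONLY, no definition / instance / notation /
new named fact; consumed BY NAME, nothing restated: abc-iut-f-142's level-dependent knit `cor219_iii_of_pointHearts_of_sq_of_origin`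
(p493568: compatible exponents by compactness, hearts by `heart_of_value_at'`, (b2) by the square vanishing), abc-iut-L1-t6's
model inputs `dense_closure_heart_record` / `toTheta_comm_record_mem_lDeltaTheta` (p488563), `toTheta_commutatorElement_eq_cThetaχq` /
`exists_zpow_red_cThetaχq_pow_eq` (p487040), abc-iut-w5-d162's `exists_sq_eq_toTheta_conj_comm_modelχq` (squares hypothesis at the model), the origin guard, the open augmentation and
the binder-free rows of the inr datum (`compat_modelχq`, `ThetaSetting.modelχq_sec2Hyps`, `prop15iii_etaleThetaDataχqInr`).

WHY THIS ROUTE.  The constant-conjugator knit (p490284/p490953) displays a value clause that a general admissible `γ` of the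
model need not satisfy (profinite-inner `Ad(â^{lu})`, `u ∈ Ẑ ∖ ℤ`: abc-iut-L6-d6 / abc-iut-w5-d162 census); the level-dependent
knit asks only, per level `M`, for SOME exponent `m` with `red_M (γ̃⁻¹ f₀(γ b̃₀)) = red_M (conjRoot (a₀^m) f₀ b̃₀)` — the
point-hearts clause (PH), which row «COR219III-M1b-EVEN (β)» (abc-iut-w5-d187, `Sec2Cor219iiiDiscrepancySquare`) supplies
from `aug (γ b̂₀) = 1`.

* (squares hypothesis `hsq` of the knit at the model = abc-iut-w5-d162's `exists_sq_eq_toTheta_conj_comm_modelχq`,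
  `Sec2Cor219iiiConjRootPeriodicityAtModelChi`, from p487040 — consumed BY NAME.)
* §1 `toTheta_comm_record_eq_zpow_neg_two` — the identity `⟨θ⁅a₀⁻¹, b₀⁆⟩ = x₀^{-2}`, `x₀ = ⟨c^{ι(1)^l}⟩` (with `red_M x₀`
  generating `μ_M`, p487040 `exists_zpow_red_cThetaχq_pow_eq`) — so far only inside p487040's proof; exported for the
  «`eq_zpow_neg_two`» input of abc-iut-w5-d187's `forall_sq_eq_red_comm_of_eq_zpow_neg_two`.
* §2 **`cor219_iii_modelχq_of_pointHearts`** — `T.Cor219_iii` at `modelχq p i j` (record `X̲̲`-choice, `l` odd, every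
  étale-theta datum `E`; binders `hC hS h15`) modulo (PH) displayed in f-142's binder shape with `a := a₀ = inl(â^l)`,
  `b := b₀ = inl(b̂^{ι(1)²})`; **`cor219_iii_modelTate_inr_of_pointHearts`** — the same at the datum OF RECORD
  `etaleThetaDataχqInr p` over `modelχq p 1 2`, binders = data `l, C, hHuu, τ` and (PH) ONLY.

HONEST LABEL: statements about the SEMI-SYNTHETIC stage-2 model of OUR typed §1 interface (binder-discharge evidence), NOT about the
tempered fundamental group of a curve; (PH) is displayed, not asserted; nothing of [EtTh] (refereed) is asserted for a curve; no
side is taken on [IUTchIII] Cor. 3.12; typed ≠ proved; instantiated ≠ endorsed.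
-/

noncomputable section

namespace Literature.AnabelianGeometry.EtaleTheta.SettingModel

open Literature.AnabelianGeometry.SemiGraphs _root_.Function _root_.Topology
open scoped commutatorElement

variable (p : ℕ) [Fact p.Prime] (i j : ℤ) (hj : Even j)

/-! ## §1. The record commutator: `⟨θ⁅a₀⁻¹, b₀⁆⟩ = x₀^{-2}` with `x₀ = ⟨c^{ι(1)^l}⟩` -/

/-- **`⟨θ⁅a₀⁻¹, b₀⁆⟩ = x₀^{-2}` in `l·Δ_Θ`** for the record pair `a₀ = inl(â^l)`, `b₀ = inl(b̂^{ι(1)²})` at `modelχq p i j`, with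
`x₀ := ⟨c^{ι(1)^l}⟩` — the element whose reductions `red_M x₀` generate every `μ_M` (`exists_zpow_red_cThetaχq_pow_eq`, p487040).
(The computation of p487040's `forall_exists_zpow_red_comm_of_odd`, exported: degree `−l` of `a₀⁻¹`, `ŷ(b₀) = ι(1)²`, the
commutator formula `toTheta_commutatorElement_eq_cThetaχq`.) [cite: MochizukiEtTh2009, Cor 2.19 (iii) p.64] -/
theorem toTheta_comm_record_eq_zpow_neg_two (l : ℕ+) :
    (⟨_, toTheta_comm_record_mem_lDeltaTheta p i j hj l⟩ : (ThetaSetting.modelχq p i j hj).lDeltaTheta l) =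
      (⟨cThetaχq p i j ((iotaZ (Multiplicative.ofAdd 1)) ^ (l : ℕ)),
        ⟨cThetaχq p i j (iotaZ (Multiplicative.ofAdd 1)), cThetaχq_mem_ker p i j _, by rw [map_pow]⟩⟩) ^ (-2 : ℤ) := by
  have ha' : ((SemidirectProduct.inl (gfpOf (FreeGroup.of 0 ^ ((l : ℕ) : ℤ))) : PiTpχq p i j)).right = 1 :=
    SemidirectProduct.right_inl _
  have hb' : ((SemidirectProduct.inl (bPowGfp ((iotaZ (Multiplicative.ofAdd 1)) ^ 2)) : PiTpχq p i j)).right = 1 :=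
    SemidirectProduct.right_inl _
  have hbY : (SemidirectProduct.inl (bPowGfp ((iotaZ (Multiplicative.ofAdd 1)) ^ 2)) : PiTpχq p i j) ∈ YNχq p i j 2 :=
    (GtpYdd_modelχq p i j hj).le (inl_bPowGfp_sq_mem_GtpYdd_modelχq p i j hj _)
  obtain ⟨⟨hZ, -⟩, -⟩ := (GfpTwistData₀.mem_YN _).mp hbY
  have hcomm : (ThetaSetting.modelχq p i j hj).toTheta
      (((SemidirectProduct.inl (gfpOf (FreeGroup.of 0 ^ ((l : ℕ) : ℤ))) : PiTpχq p i j))⁻¹ *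
        (SemidirectProduct.inl (bPowGfp ((iotaZ (Multiplicative.ofAdd 1)) ^ 2)) : PiTpχq p i j) *
        (SemidirectProduct.inl (gfpOf (FreeGroup.of 0 ^ ((l : ℕ) : ℤ))) : PiTpχq p i j) *
        ((SemidirectProduct.inl (bPowGfp ((iotaZ (Multiplicative.ofAdd 1)) ^ 2)) : PiTpχq p i j))⁻¹) =
      CurveTheta.toTheta (curveχq p i j)
        ⁅((SemidirectProduct.inl (gfpOf (FreeGroup.of 0 ^ ((l : ℕ) : ℤ))) : PiTpχq p i j))⁻¹,
          (SemidirectProduct.inl (bPowGfp ((iotaZ (Multiplicative.ofAdd 1)) ^ 2)) : PiTpχq p i j)⁆ := by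
    rw [commutatorElement_def, inv_inv]
  have hA := toTheta_commutatorElement_eq_cThetaχq p i j
    ((SemidirectProduct.inl (gfpOf (FreeGroup.of 0 ^ ((l : ℕ) : ℤ))) : PiTpχq p i j))⁻¹
    (SemidirectProduct.inl (bPowGfp ((iotaZ (Multiplicative.ofAdd 1)) ^ 2)) : PiTpχq p i j)
    (by rw [SemidirectProduct.inv_right, ha', inv_one]) hb' hZ
  have hinvleft : (((SemidirectProduct.inl (gfpOf (FreeGroup.of 0 ^ ((l : ℕ) : ℤ))) : PiTpχq p i j))⁻¹).left =
      (gfpOf (FreeGroup.of 0 ^ ((l : ℕ) : ℤ)))⁻¹ := by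
    rw [SemidirectProduct.inv_left, ha', inv_one, map_one, MulAut.one_apply, SemidirectProduct.left_inl]
  apply Subtype.ext
  show (ThetaSetting.modelχq p i j hj).toTheta _ = (cThetaχq p i j ((iotaZ (Multiplicative.ofAdd 1)) ^ (l : ℕ))) ^ (-2 : ℤ)
  rw [hcomm, hA, hinvleft, map_inv, toAdd_inv, toAdd_gfpSnd_gfpOf_zpow, yCoordχq_inl_bPowGfp p i j _, ← map_zpow]
  congr 1
  rw [← zpow_natCast, ← zpow_natCast, ← zpow_mul, ← zpow_mul]
  congr 1
  ring

/-! ## §2. Cor. 2.19 (iii) at `modelχq p i j` modulo the point-hearts clause (PH) -/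

set_option synthInstance.maxHeartbeats 200000 in
set_option maxHeartbeats 1000000 in
/-- **`ThetaEnvTower.Cor219_iii` at `modelχq p i j` (record `X̲̲`-choice, `l` odd) modulo the displayed point-hearts clause (PH)**
— one application of abc-iut-f-142's `cor219_iii_of_pointHearts_of_sq_of_origin` with `a := a₀ = inl(â^l)`, `b := b₀ =
inl(b̂^{ι(1)²})`, `h₁`, the density (D1*), the squares hypothesis (abc-iut-w5-d162's `exists_sq_eq_toTheta_conj_comm_modelχq`), the origin guard and the open augmentation discharged BY
NAME.  The two `set_option`s only raise elaboration limits for the nested subtype carriers over the `abbrev` record.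
[cite: MochizukiEtTh2009, Cor 2.19 (iii) p.65] -/
theorem cor219_iii_modelχq_of_pointHearts {E : (ThetaSetting.modelχq p i j hj).EtaleThetaData} {l : ℕ+}
    (hl : Odd (l : ℕ)) (C : E.DoubleUnderline l) (hHuu : C.Huu = Huuχq p i j l hl) {Es : Set ℕ+}
    (τ : (ThetaSetting.modelχq p i j hj).CyclotomeTower l Es)
    (hC : (ThetaSetting.modelχq p i j hj).Compat) (hS : (ThetaSetting.modelχq p i j hj).Sec2Hyps)
    (h15 : ThetaSetting.Prop15iii E hC)
    (H : ∀ (γ : (C.thetaEnvTower τ hC hS).PiX ≃ₜ* (C.thetaEnvTower τ hC hS).PiX)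
      (hγ : (C.thetaEnvTower τ hC hS).PiYdd.map γ.toMulEquiv.toMonoidHom = (C.thetaEnvTower τ hC hS).PiYdd)
      (γμ : ∀ M : Es, (C.thetaEnvTower τ hC hS).mu M ≃* (C.thetaEnvTower τ hC hS).mu M)
      (_ : ∀ (M : Es) (g : (C.thetaEnvTower τ hC hS).lDeltaTheta) (hg : γ g ∈ (C.thetaEnvTower τ hC hS).lDeltaTheta),
        (C.thetaEnvTower τ hC hS).thetaMod M ⟨γ g, hg⟩ = γμ M ((C.thetaEnvTower τ hC hS).thetaMod M g)),
      ((ThetaSetting.modelχq p i j hj).toTheta.comp C.Huu.subtype).ker.map γ.toMulEquiv.toMonoidHom =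
          ((ThetaSetting.modelχq p i j hj).toTheta.comp C.Huu.subtype).ker ∧
      (C.thetaEnvTower τ hC hS).lDeltaTheta.map γ.toMulEquiv.toMonoidHom = (C.thetaEnvTower τ hC hS).lDeltaTheta ∧
      ∀ (γΛ : (ThetaSetting.modelχq p i j hj).lDeltaTheta l ≃* (ThetaSetting.modelχq p i j hj).lDeltaTheta l)
        (_ : ∀ (g : (C.thetaEnvTower τ hC hS).lDeltaTheta) (hg : γ g ∈ (C.thetaEnvTower τ hC hS).lDeltaTheta),
          C.toLDelta ⟨γ g, hg⟩ = γΛ (C.toLDelta g)),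
        ∃ (f₀ : contCocycles (ThetaSetting.modelχq p i j hj).toTheta (ThetaSetting.modelχq p i j hj).DeltaTheta C.GtpYdduu)
          (hf₀ : f₀ ∈ C.rootCocycles hC),
          ∀ M : Es, ∃ m : ℤ,
            (τ.mod M).red (γΛ.symm ⟨(f₀.1 (C.inclYdduu ⟨γ
                (⟨⟨(SemidirectProduct.inl (bPowGfp ((iotaZ (Multiplicative.ofAdd 1)) ^ 2)) : PiTpχq p i j),
                    hHuu.ge (inl_bPowGfp_mem_Huuχq p i j l hl _)⟩,
                  inl_bPowGfp_sq_mem_GtpYdd_modelχq p i j hj _⟩ : (C.thetaEnvTower τ hC hS).PiYdd),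
                C.apply_mem_PiYdd τ hC hS γ hγ _⟩) : (ThetaSetting.modelχq p i j hj).GtpTheta), hf₀.1 _⟩) =
              (τ.mod M).red ⟨(C.conjRoot hC
                ((⟨(SemidirectProduct.inl (gfpOf (FreeGroup.of 0 ^ ((l : ℕ) : ℤ))) : PiTpχq p i j),
                    hHuu.ge (inl_gfpOf_zpow_mem_Huuχq p i j l hl)⟩ : C.Huu) ^ m) f₀.1 (C.inclYdduu
                ⟨⟨(SemidirectProduct.inl (bPowGfp ((iotaZ (Multiplicative.ofAdd 1)) ^ 2)) : PiTpχq p i j),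
                    hHuu.ge (inl_bPowGfp_mem_Huuχq p i j l hl _)⟩,
                  inl_bPowGfp_sq_mem_GtpYdd_modelχq p i j hj _⟩) : (ThetaSetting.modelχq p i j hj).GtpTheta),
                ((ThetaSetting.modelχq p i j hj).lDeltaTheta_normal l).conj_mem _ (hf₀.1 _) _⟩) :
    (C.thetaEnvTower τ hC hS).Cor219_iii :=
  C.cor219_iii_of_pointHearts_of_sq_of_origin τ (ThetaSetting.modelχq_isEtThOrigin p i j hj) hC hS h15
    (C.isOpenMap_aug_PiYdd τ hC hS (isOpenMap_aug_modelχq p i j hj))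
    ⟨(SemidirectProduct.inl (gfpOf (FreeGroup.of 0 ^ ((l : ℕ) : ℤ))) : PiTpχq p i j),
      hHuu.ge (inl_gfpOf_zpow_mem_Huuχq p i j l hl)⟩
    (SemidirectProduct.right_inl (N := Gfp) (G := GQp p) (φ := actχq p i j) (gfpOf (FreeGroup.of 0 ^ ((l : ℕ) : ℤ))))
    ⟨⟨(SemidirectProduct.inl (bPowGfp ((iotaZ (Multiplicative.ofAdd 1)) ^ 2)) : PiTpχq p i j),
        hHuu.ge (inl_bPowGfp_mem_Huuχq p i j l hl _)⟩,
      inl_bPowGfp_sq_mem_GtpYdd_modelχq p i j hj _⟩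
    (SemidirectProduct.right_inl (N := Gfp) (G := GQp p) (φ := actχq p i j) (bPowGfp ((iotaZ (Multiplicative.ofAdd 1)) ^ 2)))
    (toTheta_comm_record_mem_lDeltaTheta p i j hj l)
    (dense_closure_heart_record p i j hj hl C hHuu τ hC hS)
    (fun σ hσ k => exists_sq_eq_toTheta_conj_comm_modelχq p i j hj C hC σ hσ k) H

set_option synthInstance.maxHeartbeats 200000 in
set_option maxHeartbeats 1000000 in
/-- **`ThetaEnvTower.Cor219_iii` for the tower of the étale-theta datum OF RECORD at the Tate instance** (`modelχq p 1 2`,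
`η̈^Θ := etaDdχq` along `inr`; record `X̲̲`-choice, `l` odd) on the level-dependent route, with `Compat`, `Sec2Hyps` and
Prop. 1.5 (iii) discharged BY NAME — binders = data `l, C, hHuu, τ` and the point-hearts clause (PH) ONLY.
[cite: MochizukiEtTh2009, Cor 2.19 (iii) p.65] -/
theorem cor219_iii_modelTate_inr_of_pointHearts {l : ℕ+} (hl : Odd (l : ℕ))
    (C : (etaleThetaDataχqInr p).DoubleUnderline l) (hHuu : C.Huu = Huuχq p 1 2 l hl) {Es : Set ℕ+}
    (τ : (ThetaSetting.modelχq p 1 2 even_two).CyclotomeTower l Es)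
    (H : ∀ (γ : (C.thetaEnvTower τ (compat_modelχq p 1 2 even_two) (ThetaSetting.modelχq_sec2Hyps p 1 2 even_two)).PiX ≃ₜ*
        (C.thetaEnvTower τ (compat_modelχq p 1 2 even_two) (ThetaSetting.modelχq_sec2Hyps p 1 2 even_two)).PiX)
      (hγ : (C.thetaEnvTower τ (compat_modelχq p 1 2 even_two) (ThetaSetting.modelχq_sec2Hyps p 1 2 even_two)).PiYdd.map
          γ.toMulEquiv.toMonoidHom =
        (C.thetaEnvTower τ (compat_modelχq p 1 2 even_two) (ThetaSetting.modelχq_sec2Hyps p 1 2 even_two)).PiYdd)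
      (γμ : ∀ M : Es, (C.thetaEnvTower τ (compat_modelχq p 1 2 even_two) (ThetaSetting.modelχq_sec2Hyps p 1 2 even_two)).mu M ≃*
        (C.thetaEnvTower τ (compat_modelχq p 1 2 even_two) (ThetaSetting.modelχq_sec2Hyps p 1 2 even_two)).mu M)
      (_ : ∀ (M : Es) (g : (C.thetaEnvTower τ (compat_modelχq p 1 2 even_two) (ThetaSetting.modelχq_sec2Hyps p 1 2 even_two)).lDeltaTheta)
        (hg : γ g ∈ (C.thetaEnvTower τ (compat_modelχq p 1 2 even_two) (ThetaSetting.modelχq_sec2Hyps p 1 2 even_two)).lDeltaTheta),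
        (C.thetaEnvTower τ (compat_modelχq p 1 2 even_two) (ThetaSetting.modelχq_sec2Hyps p 1 2 even_two)).thetaMod M ⟨γ g, hg⟩ =
          γμ M ((C.thetaEnvTower τ (compat_modelχq p 1 2 even_two) (ThetaSetting.modelχq_sec2Hyps p 1 2 even_two)).thetaMod M g)),
      ((ThetaSetting.modelχq p 1 2 even_two).toTheta.comp C.Huu.subtype).ker.map γ.toMulEquiv.toMonoidHom =
          ((ThetaSetting.modelχq p 1 2 even_two).toTheta.comp C.Huu.subtype).ker ∧
      (C.thetaEnvTower τ (compat_modelχq p 1 2 even_two) (ThetaSetting.modelχq_sec2Hyps p 1 2 even_two)).lDeltaTheta.map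
          γ.toMulEquiv.toMonoidHom =
        (C.thetaEnvTower τ (compat_modelχq p 1 2 even_two) (ThetaSetting.modelχq_sec2Hyps p 1 2 even_two)).lDeltaTheta ∧
      ∀ (γΛ : (ThetaSetting.modelχq p 1 2 even_two).lDeltaTheta l ≃* (ThetaSetting.modelχq p 1 2 even_two).lDeltaTheta l)
        (_ : ∀ (g : (C.thetaEnvTower τ (compat_modelχq p 1 2 even_two) (ThetaSetting.modelχq_sec2Hyps p 1 2 even_two)).lDeltaTheta)
          (hg : γ g ∈ (C.thetaEnvTower τ (compat_modelχq p 1 2 even_two) (ThetaSetting.modelχq_sec2Hyps p 1 2 even_two)).lDeltaTheta),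
          C.toLDelta ⟨γ g, hg⟩ = γΛ (C.toLDelta g)),
        ∃ (f₀ : contCocycles (ThetaSetting.modelχq p 1 2 even_two).toTheta (ThetaSetting.modelχq p 1 2 even_two).DeltaTheta
            C.GtpYdduu)
          (hf₀ : f₀ ∈ C.rootCocycles (compat_modelχq p 1 2 even_two)),
          ∀ M : Es, ∃ m : ℤ,
            (τ.mod M).red (γΛ.symm ⟨(f₀.1 (C.inclYdduu ⟨γ
                (⟨⟨(SemidirectProduct.inl (bPowGfp ((iotaZ (Multiplicative.ofAdd 1)) ^ 2)) : PiTpχq p 1 2),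
                    hHuu.ge (inl_bPowGfp_mem_Huuχq p 1 2 l hl _)⟩,
                  inl_bPowGfp_sq_mem_GtpYdd_modelχq p 1 2 even_two _⟩ :
                  (C.thetaEnvTower τ (compat_modelχq p 1 2 even_two) (ThetaSetting.modelχq_sec2Hyps p 1 2 even_two)).PiYdd),
                C.apply_mem_PiYdd τ _ _ γ hγ _⟩) : (ThetaSetting.modelχq p 1 2 even_two).GtpTheta), hf₀.1 _⟩) =
              (τ.mod M).red ⟨(C.conjRoot (compat_modelχq p 1 2 even_two)
                ((⟨(SemidirectProduct.inl (gfpOf (FreeGroup.of 0 ^ ((l : ℕ) : ℤ))) : PiTpχq p 1 2),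
                    hHuu.ge (inl_gfpOf_zpow_mem_Huuχq p 1 2 l hl)⟩ : C.Huu) ^ m) f₀.1 (C.inclYdduu
                ⟨⟨(SemidirectProduct.inl (bPowGfp ((iotaZ (Multiplicative.ofAdd 1)) ^ 2)) : PiTpχq p 1 2),
                    hHuu.ge (inl_bPowGfp_mem_Huuχq p 1 2 l hl _)⟩,
                  inl_bPowGfp_sq_mem_GtpYdd_modelχq p 1 2 even_two _⟩) : (ThetaSetting.modelχq p 1 2 even_two).GtpTheta),
                ((ThetaSetting.modelχq p 1 2 even_two).lDeltaTheta_normal l).conj_mem _ (hf₀.1 _) _⟩) :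
    (C.thetaEnvTower τ (compat_modelχq p 1 2 even_two) (ThetaSetting.modelχq_sec2Hyps p 1 2 even_two)).Cor219_iii :=
  cor219_iii_modelχq_of_pointHearts p 1 2 even_two hl C hHuu τ (compat_modelχq p 1 2 even_two)
    (ThetaSetting.modelχq_sec2Hyps p 1 2 even_two) (prop15iii_etaleThetaDataχqInr p _) H

end Literature.AnabelianGeometry.EtaleTheta.SettingModel

end
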